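import Summits.AtomisticToContinuum.HydrodynamicLimit.Theorems.AntiMazurCoboundariesKineticFluxLdDecayHTheoremObjectsB
import HarnessLib

/-!
# Objects of the crux line `h-theorem-dissipation-budget`, part C: the bet ON THE CRUX'S OWN TILT
# (crux `KineticFluxLdDecay`, stmt-AtomisticToContinuum-10967; lead a2, reshape 2)

Why a part C. Every form of the line's bet that quantifies over ALL finite-entropy initial laws `ν` — the card's
`C⁺`, the objects module's `NoPerpetualDissipation`, and part B's density-cut repair `NoPerpetualDissipationBdd` — is
FALSE by the MACROSTATE-MIXTURE artefact: `ν = ½(G⁺ + G⁻)`, the even mixture of the two flow-INVARIANT homogeneous Gibbs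
laws at temperatures `θ(1 ± Δ)` (cost `KL(ν‖G_N) ≍ (N+1)Δ²`, density `n ≡ 1`, below every cut), is itself invariant, no
realisation ever dissipates (each component is an equilibrium), yet its ENSEMBLE one-body velocity law is the mixture
`½(M₊ + M₋)`, non-Maxwellian, with Hellinger production `≍ Δ⁴` per unit time FOREVER: `∫₀ʰ production = h·cΔ⁴` against a
budget `(h/τ)(A Δ² + B)`, violated for `τ > (AΔ² + B)/(cΔ⁴)` (lead a2, `Lines/h_theorem_dissipation_budget.md` §reshape 2).
Boltzmann's functional of the ENSEMBLE-averaged one-body law mis-measures dissipation on statistical superpositions of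
macrostates — the deterministic system has conserved quantities, hence a continuum of invariant Gibbs laws and their
mixtures, which no reversible Markov caricature with a unique stationary law possesses (this is where the card's
caricature heuristic "sup = 4" breaks). The crux itself survives mixtures through its amplitude clause (mixture gains
are second order in `Δ`, paid by the first-order entropy cost), and the composition only ever applies the bet to ONE
law: the crux's own optimal enemy, the tilted law `ν = G_N^X`, `X = h⁻¹∫₀ʰ F∘Φ_t dt`, which inherits the canonical
concentration of the conserved fields (temperature spread `≍ N^{-1/2}` under the amplitude clause, by strict convexity
of the tilted rate function near `G_N`). Hence the bet is now stated for that law only: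

* `NoPerpetualDissipationTilt` — `C⁺_{K,X}`: for admissible `φ, g` (`|g| ≤ κ_b`, an amplitude of the bet) and every cut
  level `K ≥ 1` there are `A, B` with `∫₀ʰ production(cut one-body density of G_N^X at time t) dt ≤ (h/τ)(A s + B)`,
  `s = KL(G_N^X ‖ G_N)/(N+1)`, for every window `τ`, all large `N` and every flow.

The density cut of part B is kept (the point-density artefact is a property of the functional, and bounded one-body
density of `G_N^X` is itself a dynamical influence statement); `GainDominationLocal` and `PositionTailBudget` are unchanged.
-/

noncomputable section

open MeasureTheory ProbabilityTheory Set Filter InformationTheory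
open scoped ENNReal

namespace Summit.AtomisticToContinuum.HydrodynamicLimit.Theorems.HTheorem

open Literature.MathematicalPhysics.KineticTheory (T3 V3 hsDiameter localGibbsLaw)
open Literature.Analysis.FluidPDE (HardSphereFlow Config)

/-- The crux's OPTIMAL ENEMY: the global Gibbs law tilted by the window average of the flux observable,
`G_N^X = e^X G_N / E_{G_N} e^X`, `X = h⁻¹ ∫₀ʰ Σᵢ φ(xᵢ(t)) g(wᵢ(t)) dt`, `h = τ (N+1)^{-1/3}` (the Donsker–Varadhan maximiser:
`log E_{G_N} e^X = E_{G_N^X} X − KL(G_N^X ‖ G_N)`, stub `WindowDuality`). -/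
def tiltedGibbs (σ a θ : ℝ) (u₀ : V3) (φ : T3 → ℝ) (g : V3 → ℝ) (τ : ℝ) (N : ℕ) (Φ : Flow σ N) :
    Measure (Phase N) :=
  (gibbs σ a θ u₀ N Φ).tilted (windowAvg Φ (fluxObs θ u₀ φ g N) (window τ N))

/-- Statement of `stub_noPerpetualDissipationTilt` — **`C⁺_{K,X}` = NO PERPETUAL DISSIPATION OF THE OPTIMAL ENEMY (the
bet; the one deterministic, `N`-uniform stub of the line).** For constant profiles `(a, θ, u₀)` and small reduced density
`σ < σ₀` there is an amplitude `κ_b > 0` such that for all continuous `|φ| ≤ 1`, `|g| ≤ κ_b` with `g ⊥ span{1, v, |v|²}` and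
every cut level `K ≥ 1` there are constants `A, B ≥ 0` such that for every kinetic window `τ`, all large `N` and every flow,
the time-integrated Hellinger production of the CUT reduced one-body density of the TILTED law `G_N^X` over the window
`h = τ(N+1)^{-1/3}` is budgeted by its entropy per particle: `∫₀ʰ 𝒟(ρ_t 1_{n_t ≤ K}) dt ≤ (h/τ)(A·KL(G_N^X‖G_N)/(N+1) + B)`.
At linear response `ρ_t − 1 ≈ (2/τ')φ⊗L⁻¹g` and the bound holds with `A ≈ 4/(σ²√θ)` (tight against `s ≈ κ²DF/τ'`); its
negation is a perpetual anti-dissipation machine driven by the crux's own tilt. -/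
def NoPerpetualDissipationTilt : Prop :=
  ∀ (a θ : ℝ) (u₀ : V3), 0 < a → 0 < θ → ∃ σ₀ : ℝ, 0 < σ₀ ∧ ∀ σ : ℝ, 0 < σ → σ < σ₀ →
    ∃ κb : ℝ, 0 < κb ∧ ∀ (φ : T3 → ℝ) (g : V3 → ℝ), Continuous φ → Continuous g →
      (∀ x, |φ x| ≤ 1) → (∀ w, |g w| ≤ κb) → Orthogonal g →
      ∀ K : ℝ, 1 ≤ K → ∃ A B : ℝ, 0 ≤ A ∧ 0 ≤ B ∧ ∀ τ : ℝ, 0 < τ → ∃ N₀ : ℕ, ∀ N : ℕ, N₀ ≤ N →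
        ∀ Φ : Flow σ N,
          ∫⁻ t in Set.Ioo 0 (window τ N),
              production (cutDensity K θ u₀ Φ (tiltedGibbs σ a θ u₀ φ g τ N Φ) t) ≤
            ENNReal.ofReal (window τ N / τ *
              (A * (klDiv (tiltedGibbs σ a θ u₀ φ g τ N Φ) (gibbs σ a θ u₀ N Φ)).toReal /
                ((N + 1 : ℕ) : ℝ) + B))

/-! ### Bookkeeping sub-goal of part C -/

/-- Statement of the bookkeeping sub-goal `stub_hTheoremObjectsC`: the tilted law is literally the tilt the composition
builds (so the bet is applied to the composition's `ν` by `rfl`). -/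
def HTheoremObjectsCBasic : Prop :=
  ∀ (σ a θ : ℝ) (u₀ : V3) (φ : T3 → ℝ) (g : V3 → ℝ) (τ : ℝ) (N : ℕ) (Φ : Flow σ N),
    tiltedGibbs σ a θ u₀ φ g τ N Φ =
      (gibbs σ a θ u₀ N Φ).tilted (windowAvg Φ (fluxObs θ u₀ φ g N) (window τ N))

/-- **Bookkeeping sub-goal of part C** (`stub_hTheoremObjectsC`). -/
theorem stub_hTheoremObjectsC : HTheoremObjectsCBasic := fun _ _ _ _ _ _ _ _ _ => rfl

end Summit.AtomisticToContinuum.HydrodynamicLimit.Theorems.HTheorem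

end
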